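import Summits.QuantumAdvantage.QuantumAdvantage.Theorems.NearExactIsExact.Negative.NoCaseATwelve

/-!
# Crux `CubicForrelation.NearExactIsExact` (stmt-QuantumAdvantage-14043) — n = 12: the DUAL FORM LEMMA — the cubic part of the digit
  class of a type-O cubic is the PERFECT-MATCHING DUAL of its cubic part

Certificate seat `b2b-cforr-cert` (gen 33).  HONEST FRAMING: kernel-checked finite-slice identities (standard axioms) about cubic Boolean
functions on 12 bits — structure for the one remaining case of the open window `(57/64, 29/32)` of the 12-bit slice ("E1280-even",
see …TwelveDigitWeightReduction).  Nothing is excluded here; NO value of `θ₁₂`; NOT summit progress.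

Let `g = polyPhase p` with `deg p ≤ 3` on 12 bits, `W_g = 16u`.  For a coordinate `3`-set `T` write `E_T` for the `3`-cube
`{x : supp x ⊆ T}` and `N₃(Tᶜ)` for the number of `3`-sets of monomials of `p` whose supports TILE the `9`-set `Tᶜ` (necessarily three
pairwise disjoint cubic monomials — "perfect matchings of `Tᶜ` by the monomial 3-graph").
* `tdf_cube3_sum`: `Σ_{x ∈ E_T} u(x) = −4·N₃(Tᶜ) + 8k` (Poisson summation over `E_T` + the saturated-term congruence `cube_bias_congr`
  with `m = 3` on the `9`-cube `E_{Tᶜ}`; the `m = 3` companion of the type-O criterion `bias ≡ 16·N₄ (mod 32)` of `no_caseA`).  No parity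
  hypothesis on `u` is needed.
* `tdf_cube3_digit`: if `g` is of type O (`u = 2u₁ + 1`, `u₁ = 2u₂ + t`, `t = [u₁ odd]`), then `#{x ∈ E_T : u₂(x) odd} ≡ N₃(Tᶜ) (mod 2)`:
  the coefficient of `y_T` in the algebraic normal form of the CUBIC third digit `d₂ = [u₂ odd]` (`digit_three`) is the matching parity
  `N₃(Tᶜ) mod 2`.
* `tdf_cube3_class`: the same for the DIGIT CLASS `E = {u ≡ ±1 (mod 8)} = {d₁ = d₂}`: `#(E ∩ E_T) ≡ N₃(Tᶜ) (mod 2)` — the cubic part of the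
  cubic `1_E` is the "matching dual" `C* = {T : N₃(Tᶜ) odd}` of the monomial 3-graph `C` of `g` (whose own matching number `N₄` is odd,
  `no_caseA`).  Companion: …TwelveDigitPairing (`Σ_{jk : vjk ∈ C} C*_{wjk} = [v = w]`).

References: J. Ax (1964) / R. J. McEliece (1972); C. Carlet (2021) §2.2, §4.1; MacWilliams–Sloane (1977) Ch. 13–15.  Axioms: the
standard three.
-/

set_option linter.dupNamespace false -- D-0017: single-problem summit ⇒ `QuantumAdvantage.QuantumAdvantage` by design

noncomputable section

namespace Summit.QuantumAdvantage.QuantumAdvantage.Theorems.CubicForrelation.NearExactIsExact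

open Finset
open Literature.Computability.QuantumComplexity
open Literature.Computability.QuantumComplexity.DerivativeWalsh (W)
open Summit.QuantumAdvantage.QuantumAdvantage.Theorems.NearExactIsExact.Negative.TypeOTwelve
  (cube_bias_congr card_cube_int digit_two)

section DualForm

variable (g : (Fin (6 + 6) → Bool) → Bool) (p : MvPolynomial (Fin (6 + 6)) (ZMod 2)) (u : (Fin (6 + 6) → Bool) → ℤ)

/-- **Cube sums over `3`-cubes see the `9`-cube matchings.**  For `g = polyPhase p`, `deg p ≤ 3`, `W_g = 16u` and a coordinate set `T`
with `|T| = 3`: `Σ_{x ∈ E_T} u(x) = −4·N₃(Tᶜ) + 8k`, where `N₃(Tᶜ)` counts the `3`-sets of monomials of `p` whose supports tile `Tᶜ`.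
[this work] -/
theorem tdf_cube3_sum (hp : p.totalDegree ≤ 3) (hrep : ∀ x, g x = polyPhase p x)
    (hu : ∀ x, W (fun y => signOf (g y)) x = (2 : ℝ) ^ 4 * (u x : ℝ)) (T : Finset (Fin (6 + 6))) (hT : #T = 3) :
    ∃ k : ℤ, ∑ x ∈ {x : Fin (6 + 6) → Bool | ∀ i, x i = true → i ∈ T}, u x =
      -4 * (#{S' ∈ p.support.powerset | #S' = 3 ∧ (S'.biUnion fun s => s.support) = Tᶜ} : ℕ) + 8 * k := by
  -- the integer bias sum over the `9`-cube `E_{Tᶜ}`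
  have hbias : ∑ x ∈ {x : Fin (6 + 6) → Bool | ∀ i, x i = true → i ∈ Tᶜ}, signOf (g x) =
      ((∑ x ∈ {x : Fin (6 + 6) → Bool | ∀ i, x i = true → i ∈ Tᶜ},
        ∏ s ∈ p.support, (if (∀ j ∈ s.support, x j = true) then (-1 : ℤ) else 1) : ℤ) : ℝ) := by
    rw [Int.cast_sum]
    exact sum_congr rfl fun x _ => by rw [hrep x, ax_signOf_polyPhase]
  -- Poisson summation: `16 Σ_{E_T} u = 2^{|T|} Σ_{E_{Tᶜ}} (−1)^g`
  have hpois : (2 : ℝ) ^ 4 * ∑ x ∈ {x : Fin (6 + 6) → Bool | ∀ i, x i = true → i ∈ T}, (u x : ℝ) =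
      (2 : ℝ) ^ #T * ∑ y ∈ {x : Fin (6 + 6) → Bool | ∀ i, x i = true → i ∈ Tᶜ}, signOf (g y) := by
    have hP := bb_poisson (fun y => signOf (g y)) T
    rw [sum_congr rfl fun x _ => hu x, ← mul_sum] at hP
    exact hP
  obtain ⟨k₃, hk₃⟩ := cube_bias_congr p hp Tᶜ 3 (by rw [card_compl, Fintype.card_fin, hT])
  rw [hT, hbias, hk₃] at hpois
  have hz : (2 : ℤ) ^ 4 * ∑ x ∈ {x : Fin (6 + 6) → Bool | ∀ i, x i = true → i ∈ T}, u x =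
      2 ^ 3 * ((-2) ^ 3 *
        (#{S' ∈ p.support.powerset | #S' = 3 ∧ (S'.biUnion fun s => s.support) = Tᶜ} : ℕ) + 2 ^ (3 + 1) * k₃) := by
    exact_mod_cast hpois
  refine ⟨k₃, ?_⟩
  have h16 : (16 : ℤ) * ∑ x ∈ {x : Fin (6 + 6) → Bool | ∀ i, x i = true → i ∈ T}, u x =
      16 * (-4 * (#{S' ∈ p.support.powerset | #S' = 3 ∧ (S'.biUnion fun s => s.support) = Tᶜ} : ℕ) + 8 * k₃) := by
    rw [show (16 : ℤ) = 2 ^ 4 by norm_num, hz]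
    ring
  exact mul_left_cancel₀ (by norm_num : (16 : ℤ) ≠ 0) h16

/-- **DUAL FORM LEMMA (digit version).**  For a TYPE-O cubic `g = polyPhase p` on 12 bits (`W_g = 16u`, `u = 2u₁ + 1`,
`u₁ = 2u₂ + t`, `t = [u₁ odd]`) and `|T| = 3`: `#{x ∈ E_T : u₂(x) odd} ≡ N₃(Tᶜ) (mod 2)` — the ANF coefficient of the cubic third
digit `[u₂ odd]` at `T` is the parity of the number of perfect matchings of `Tᶜ` by cubic monomials of `p`.
(`Σ_{E_T} u = 8 + 2Σt + 4Σu₂` with `Σ_{E_T} t ∈ 4ℤ` because `t` is affine — `digit_two` + Ax with `d = 1`.) [this work] -/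
theorem tdf_cube3_digit (hp : p.totalDegree ≤ 3) (hrep : ∀ x, g x = polyPhase p x)
    (hu : ∀ x, W (fun y => signOf (g y)) x = (2 : ℝ) ^ 4 * (u x : ℝ))
    (u₁ u₂ t : (Fin (6 + 6) → Bool) → ℤ) (h1 : ∀ x, u x = 2 * u₁ x + 1) (h2 : ∀ x, u₁ x = 2 * u₂ x + t x)
    (ht : ∀ x, t x = if Odd (u₁ x) then 1 else 0) (T : Finset (Fin (6 + 6))) (hT : #T = 3) :
    #{x ∈ ({x : Fin (6 + 6) → Bool | ∀ i, x i = true → i ∈ T} : Finset _) | Odd (u₂ x)} % 2 =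
      #{S' ∈ p.support.powerset | #S' = 3 ∧ (S'.biUnion fun s => s.support) = Tᶜ} % 2 := by
  have hg : IsDegLeFun 3 g := ⟨p, hp, hrep⟩
  obtain ⟨k, hk⟩ := tdf_cube3_sum g p u hp hrep hu T hT
  -- the affine second digit has weight `≡ 0 (mod 4)` on the `3`-cube `E_T`
  have hτ : IsDegLeFun 1 (fun x => decide (Odd (u₁ x))) := digit_two g u hg hu u₁ h1
  obtain ⟨z, hz⟩ := stub_axParity (6 + 6) 1 (fun x => decide (Odd (u₁ x))) T le_rfl hτ
  have hexp : (#T + 1 - 1) / 1 = 3 := by rw [hT]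
  rw [hexp] at hz
  have hsign : ∀ x, signOf (decide (Odd (u₁ x))) = 1 - 2 * (t x : ℝ) := fun x => by
    rw [ht x]
    by_cases h : Odd (u₁ x)
    · simp [h, signOf]; norm_num
    · simp [h, signOf]
  rw [sum_congr rfl fun x _ => hsign x, sum_sub_distrib, sum_const, nsmul_eq_mul, mul_one, ← mul_sum] at hz
  have hcardR : ((#({x : Fin (6 + 6) → Bool | ∀ i, x i = true → i ∈ T} : Finset _) : ℕ) : ℝ) = (2 : ℝ) ^ 3 := by
    rw [bb_card_cube T, hT]
    norm_num
  rw [hcardR] at hz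
  have hTz : (2 : ℤ) ^ 3 - 2 * ∑ x ∈ {x : Fin (6 + 6) → Bool | ∀ i, x i = true → i ∈ T}, t x = 2 ^ 3 * z := by
    exact_mod_cast hz
  -- `Σ_{E_T} u = 4 Σ u₂ + 2 Σ t + 8`
  have hsum : ∑ x ∈ {x : Fin (6 + 6) → Bool | ∀ i, x i = true → i ∈ T}, u x =
      4 * ∑ x ∈ {x : Fin (6 + 6) → Bool | ∀ i, x i = true → i ∈ T}, u₂ x +
        2 * ∑ x ∈ {x : Fin (6 + 6) → Bool | ∀ i, x i = true → i ∈ T}, t x + 2 ^ #T := by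
    rw [sum_congr rfl fun x _ => by rw [h1 x, h2 x], sum_add_distrib, sum_const, nsmul_eq_mul, mul_one,
      card_cube_int, mul_sum, mul_sum, ← sum_add_distrib]
    exact congrArg (· + _) (sum_congr rfl fun x _ => by ring)
  rw [hT] at hsum
  have hpar : ∃ r : ℤ, ∑ x ∈ {x : Fin (6 + 6) → Bool | ∀ i, x i = true → i ∈ T}, u₂ x =
      (#{S' ∈ p.support.powerset | #S' = 3 ∧ (S'.biUnion fun s => s.support) = Tᶜ} : ℕ) + 2 * r := by
    refine ⟨(∑ x ∈ {x : Fin (6 + 6) → Bool | ∀ i, x i = true → i ∈ T}, u₂ x -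
      (#{S' ∈ p.support.powerset | #S' = 3 ∧ (S'.biUnion fun s => s.support) = Tᶜ} : ℕ)) / 2, ?_⟩
    generalize ∑ x ∈ {x : Fin (6 + 6) → Bool | ∀ i, x i = true → i ∈ T}, u x = A at hk hsum
    generalize ∑ x ∈ {x : Fin (6 + 6) → Bool | ∀ i, x i = true → i ∈ T}, u₂ x = B at hsum ⊢
    generalize ∑ x ∈ {x : Fin (6 + 6) → Bool | ∀ i, x i = true → i ∈ T}, t x = C at hTz hsum
    generalize (#{S' ∈ p.support.powerset | #S' = 3 ∧ (S'.biUnion fun s => s.support) = Tᶜ} : ℕ) = N at hk ⊢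
    omega
  obtain ⟨r, hr⟩ := hpar
  -- parity of the number of odd `u₂` on the cube = parity of `Σ u₂`
  have hodd_count : (#{x ∈ ({x : Fin (6 + 6) → Bool | ∀ i, x i = true → i ∈ T} : Finset _) | Odd (u₂ x)} : ℤ) % 2 =
      (∑ x ∈ {x : Fin (6 + 6) → Bool | ∀ i, x i = true → i ∈ T}, u₂ x) % 2 := by
    have key : ∀ s : Finset (Fin (6 + 6) → Bool), (#(s.filter fun x => Odd (u₂ x)) : ℤ) % 2 = (∑ x ∈ s, u₂ x) % 2 := by
      intro s
      induction s using Finset.induction_on with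
      | empty => simp
      | insert a s ha ih =>
        rw [sum_insert ha, filter_insert]
        by_cases hao : Odd (u₂ a)
        · rw [if_pos hao, card_insert_of_notMem (by simp [ha]), Nat.cast_add, Nat.cast_one, Int.add_emod, ih,
            Int.add_emod (u₂ a)]
          have : u₂ a % 2 = 1 := Int.odd_iff.1 hao
          rw [this]
          omega
        · rw [if_neg hao, ih, Int.add_emod]
          have : u₂ a % 2 = 0 := Int.even_iff.1 (Int.not_odd_iff_even.1 hao)
          rw [this]
          simp
    exact key _
  have hfin : ((#{x ∈ ({x : Fin (6 + 6) → Bool | ∀ i, x i = true → i ∈ T} : Finset _) | Odd (u₂ x)} : ℕ) : ℤ) % 2 =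
      ((#{S' ∈ p.support.powerset | #S' = 3 ∧ (S'.biUnion fun s => s.support) = Tᶜ} : ℕ) : ℤ) % 2 := by
    rw [hodd_count, hr]
    omega
  exact_mod_cast hfin

/-- **DUAL FORM LEMMA (class version).**  For a type-O cubic `g = polyPhase p` on 12 bits and `|T| = 3`, the DIGIT CLASS
`E = {x : u(x) ≡ ±1 (mod 8)}` (a cubic support, `= {[u₁ odd] = [u₂ odd]}`) satisfies `#(E ∩ E_T) ≡ N₃(Tᶜ) (mod 2)`: the cubic part of
`1_E` is the matching dual `C* = {T : N₃(Tᶜ) odd}` of the monomial 3-graph of `p`.  (Pointwise `[x ∈ E] + [u₁ odd] + [u₂ odd]` is odd, and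
`#{x ∈ E_T : u₁ odd} = Σ_{E_T} t ∈ 4ℤ`.) [this work] -/
theorem tdf_cube3_class (hp : p.totalDegree ≤ 3) (hrep : ∀ x, g x = polyPhase p x)
    (hu : ∀ x, W (fun y => signOf (g y)) x = (2 : ℝ) ^ 4 * (u x : ℝ)) (hodd : ∀ x, Odd (u x))
    (T : Finset (Fin (6 + 6))) (hT : #T = 3) :
    #{x ∈ ({x : Fin (6 + 6) → Bool | ∀ i, x i = true → i ∈ T} : Finset _) | u x % 8 = 1 ∨ u x % 8 = 7} % 2 =
      #{S' ∈ p.support.powerset | #S' = 3 ∧ (S'.biUnion fun s => s.support) = Tᶜ} % 2 := by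
  have hg : IsDegLeFun 3 g := ⟨p, hp, hrep⟩
  have hodd' : ∀ x, u x % 2 = 1 := fun x => Int.odd_iff.1 (hodd x)
  obtain ⟨u₁, h1⟩ : ∃ u₁ : (Fin (6 + 6) → Bool) → ℤ, ∀ x, u x = 2 * u₁ x + 1 :=
    ⟨fun x => (u x - 1) / 2, fun x => by
      show u x = 2 * ((u x - 1) / 2) + 1
      have := hodd' x
      omega⟩
  obtain ⟨t, ht2⟩ : ∃ t : (Fin (6 + 6) → Bool) → ℤ, ∀ x, t x = u₁ x % 2 := ⟨fun x => u₁ x % 2, fun x => rfl⟩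
  obtain ⟨u₂, h2⟩ : ∃ u₂ : (Fin (6 + 6) → Bool) → ℤ, ∀ x, u₁ x = 2 * u₂ x + t x :=
    ⟨fun x => u₁ x / 2, fun x => by
      show u₁ x = 2 * (u₁ x / 2) + t x
      have := ht2 x
      omega⟩
  have ht : ∀ x, t x = if Odd (u₁ x) then 1 else 0 := fun x => by
    by_cases h : Odd (u₁ x)
    · rw [if_pos h, ht2 x]; exact Int.odd_iff.1 h
    · rw [if_neg h, ht2 x]; exact Int.even_iff.1 (Int.not_odd_iff_even.1 h)
  have hdig := tdf_cube3_digit g p u hp hrep hu u₁ u₂ t h1 h2 ht T hT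
  -- `#{x ∈ E_T : u₁ odd} = Σ_{E_T} t ∈ 4ℤ` (affine digit on a `3`-cube)
  have hτ : IsDegLeFun 1 (fun x => decide (Odd (u₁ x))) := digit_two g u hg hu u₁ h1
  obtain ⟨z, hz⟩ := stub_axParity (6 + 6) 1 (fun x => decide (Odd (u₁ x))) T le_rfl hτ
  have hexp : (#T + 1 - 1) / 1 = 3 := by rw [hT]
  rw [hexp, bb_sum_signOf] at hz
  simp only [decide_eq_true_eq] at hz
  have hcardR : ((#({x : Fin (6 + 6) → Bool | ∀ i, x i = true → i ∈ T} : Finset _) : ℕ) : ℝ) = (2 : ℝ) ^ 3 := by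
    rw [bb_card_cube T, hT]
    norm_num
  rw [hcardR] at hz
  have h1odd : ((#(univ.filter fun x : Fin (6 + 6) → Bool =>
      (∀ i, x i = true → i ∈ T) ∧ Odd (u₁ x)) : ℕ) : ℤ) = 4 - 4 * z := by
    have h' : (((#(univ.filter fun x : Fin (6 + 6) → Bool => (∀ i, x i = true → i ∈ T) ∧ Odd (u₁ x)) : ℕ) : ℤ) : ℝ) =
        ((4 - 4 * z : ℤ) : ℝ) := by
      push_cast
      linarith
    exact_mod_cast h'
  -- pointwise: `[class] + [u₁ odd] + [u₂ odd]` is odd; sum over the cube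
  have hpt : ∀ x, ((if (u x % 8 = 1 ∨ u x % 8 = 7) then 1 else 0 : ℤ) + (if Odd (u₁ x) then 1 else 0) +
      (if Odd (u₂ x) then 1 else 0)) % 2 = 1 := by
    intro x
    have e1 := h1 x
    have e2 := h2 x
    have e3 := ht2 x
    by_cases a : Odd (u₂ x) <;> by_cases b : Odd (u₁ x)
    · rw [if_pos a, if_pos b]
      have ha := Int.odd_iff.1 a; have hb := Int.odd_iff.1 b
      have : u x % 8 = 1 ∨ u x % 8 = 7 := by omega
      rw [if_pos this]; decide
    · rw [if_pos a, if_neg b]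
      have ha := Int.odd_iff.1 a; have hb := Int.even_iff.1 (Int.not_odd_iff_even.1 b)
      have : ¬ (u x % 8 = 1 ∨ u x % 8 = 7) := by omega
      rw [if_neg this]; decide
    · rw [if_neg a, if_pos b]
      have ha := Int.even_iff.1 (Int.not_odd_iff_even.1 a); have hb := Int.odd_iff.1 b
      have : ¬ (u x % 8 = 1 ∨ u x % 8 = 7) := by omega
      rw [if_neg this]; decide
    · rw [if_neg a, if_neg b]
      have ha := Int.even_iff.1 (Int.not_odd_iff_even.1 a); have hb := Int.even_iff.1 (Int.not_odd_iff_even.1 b)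
      have : u x % 8 = 1 ∨ u x % 8 = 7 := by omega
      rw [if_pos this]; decide
  set ET : Finset (Fin (6 + 6) → Bool) := {x : Fin (6 + 6) → Bool | ∀ i, x i = true → i ∈ T} with hET
  have hcardET : (#ET : ℤ) = 8 := by
    rw [hET, card_cube_int, hT]; norm_num
  have hsum3 : (∑ x ∈ ET, (((if (u x % 8 = 1 ∨ u x % 8 = 7) then 1 else 0 : ℤ) + (if Odd (u₁ x) then 1 else 0) +
      (if Odd (u₂ x) then 1 else 0)))) % 2 = 0 := by
    have key : ∀ s : Finset (Fin (6 + 6) → Bool), (∑ x ∈ s, (((if (u x % 8 = 1 ∨ u x % 8 = 7) then 1 else 0 : ℤ) +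
        (if Odd (u₁ x) then 1 else 0) + (if Odd (u₂ x) then 1 else 0)))) % 2 = (#s : ℤ) % 2 := by
      intro s
      induction s using Finset.induction_on with
      | empty => simp
      | insert a s ha ih =>
        rw [sum_insert ha, card_insert_of_notMem ha, Int.add_emod, ih, hpt a, Nat.cast_add, Nat.cast_one]
        omega
    rw [key, hcardET]
    decide
  rw [sum_add_distrib, sum_add_distrib, sum_boole, sum_boole, sum_boole] at hsum3
  have hA : (#(ET.filter fun x => Odd (u₁ x)) : ℤ) = 4 - 4 * z := by
    rw [← h1odd, hET, filter_filter]
  have hfin : ((#(ET.filter fun x => u x % 8 = 1 ∨ u x % 8 = 7) : ℕ) : ℤ) % 2 =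
      ((#(ET.filter fun x => Odd (u₂ x)) : ℕ) : ℤ) % 2 := by
    rw [hA] at hsum3
    omega
  have hfinN : (#(ET.filter fun x => u x % 8 = 1 ∨ u x % 8 = 7)) % 2 = (#(ET.filter fun x => Odd (u₂ x))) % 2 := by
    exact_mod_cast hfin
  rw [hfinN]
  exact hdig

end DualForm

end Summit.QuantumAdvantage.QuantumAdvantage.Theorems.CubicForrelation.NearExactIsExact

end
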